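import Summits.BirchSwinnertonDyer.BirchSwinnertonDyer.Theorems.PrintX8VSPublishedInputsX8CoreSlimPoitouTate
import Summits.BirchSwinnertonDyer.BirchSwinnertonDyer.Theorems.SchneiderFreeAdditiveX3PoitouTateSelmerDualityHolds
import HarnessLib

set_option linter.dupNamespace false -- `…BirchSwinnertonDyer.BirchSwinnertonDyer…` is the cell's nested layout (D-0017)
set_option autoImplicit false

/-!
# `PrintX8VS`: child `InputLem59AllN` (19878), pack `PublishedInputsX8Core` (23004) and bundle `PublishedInputsX8` (20403) ⟸ the
# E-specific prints + the SINGLE Poitou–Tate row PT-Ш(ℚ) — PT-Sel discharged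
# (LADDER-BSD D-0154 (2), INPUTS-LIST-2 ADDENDUM-9 §0.11 entry T13, PrintX8VS half)

Seat `bsd-inputs-honda-p1` (gen 6, idle INPUTS prover of the desk `pub/bsd-wall/bsd-inputs`), `--supports`
stmt-BirchSwinnertonDyer-23004 (also serves 19878 on `PrintX8VS` and the bundle 20403). THEOREMS ONLY (no definition, no named fact,
no `sorry`); pure re-export, no new mathematics.

T7 (`Theorems/PrintX8VSPublishedInputsX8CoreSlimPoitouTate.lean`, pack-p1 g2, p620570) proved `printX8VS_inputLem59AllN_of_poitouTate`,
`publishedInputsX8Core_of_slim_poitouTate`, `publishedInputsX8_of_slim_poitouTate`, `publishedInputsX8_of_slim_period_poitouTate`, each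
binding the two generic CFT rows `(hPTs : poitouTate_selmerStructure_duality ℚ) (hPT : poitouTate_sha_tateDual ℚ)`. Since
2026-08-28T10:27Z the first row is a THEOREM OF THE TREE:
`SchneiderFreeAdditiveX3.PoitouTateReduction.poitouTate_selmerStructure_duality_holds (K)` (cell `bsd-schneider`, door-c4 g18, p624636;
item 20461 closed by p625477). This file substitutes it: the displayed base of pack 23004 becomes the 4 E-specific print inputs
{BKO A.5♯♭ (20412), Modularity (19382), Sprung 2012 Thm. 7.14 (20414), Thm. 7.16 (20415)} + PT-Ш(ℚ) (20462) — FIVE.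

Honest framing: CONDITIONAL doors; 19878 / 23004 / 20403 are NOT closed; no crux and no summit statement is proved; BSD is not proved
by any of this. References: [Sprung2024, Lemma 5.9, §5.2]; [Sprung2012, Thms. 2.2, 7.14, 7.16]; [MilneADT2006] Ch. I, Thm. 4.10.
-/

noncomputable section

namespace Summit.BirchSwinnertonDyer.BirchSwinnertonDyer.Theorems

open Literature.NumberTheory.GaloisCohomology Literature.NumberTheory.EllipticCurves
  Summit.BirchSwinnertonDyer.BirchSwinnertonDyer.Theses.PrintX8VS

/-- **Route `PrintX8VS`, child `InputLem59AllN` (item 19878) ⟸ PT-Ш(ℚ) ALONE**: `printX8VS_inputLem59AllN_of_poitouTate` with its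
PT-Sel row discharged by `SchneiderFreeAdditiveX3.PoitouTateReduction.poitouTate_selmerStructure_duality_holds ℚ`. Conditional on
`poitouTate_sha_tateDual ℚ` (item 20462); closes nothing; BSD is not proved by this. [cite: Sprung2024, Lemma 5.9]
[cite: MilneADT2006, Ch. I, Thm. 4.10] -/
theorem printX8VS_inputLem59AllN_of_poitouTateSha (hPT : poitouTate_sha_tateDual ℚ) :
    Summit.BirchSwinnertonDyer.BirchSwinnertonDyer.Theses.PrintX8VS.InputLem59AllN :=
  printX8VS_inputLem59AllN_of_poitouTate
    (SchneiderFreeAdditiveX3.PoitouTateReduction.poitouTate_selmerStructure_duality_holds ℚ) hPT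

/-- **Pack `PublishedInputsX8Core` (item 23004) from FOUR E-specific print children + PT-Ш(ℚ)**: `publishedInputsX8Core_of_slim_poitouTate`
with PT-Sel discharged. Displayed base of the pack: {`InputBKOCorA5SharpFlat`, `InputNewform`, `InputSharpFlatTorsion`,
`InputKatoSharpFlatDivisibility`} + `poitouTate_sha_tateDual ℚ`. Conditional; closes nothing; BSD is not proved by this.
[cite: Sprung2024, §5.2 and Lemma 5.9] [cite: MilneADT2006, Ch. I, Thm. 4.10] -/
theorem publishedInputsX8Core_of_slim_poitouTateSha
    (hBKO : InputBKOCorA5SharpFlat) (hmod : InputNewform) (hTors : InputSharpFlatTorsion) (hKato : InputKatoSharpFlatDivisibility)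
    (hPT : poitouTate_sha_tateDual ℚ) :
    Summit.BirchSwinnertonDyer.BirchSwinnertonDyer.Theses.PrintX8VS.PublishedInputsX8Core :=
  publishedInputsX8Core_of_slim_poitouTate hBKO hmod hTors hKato
    (SchneiderFreeAdditiveX3.PoitouTateReduction.poitouTate_selmerStructure_duality_holds ℚ) hPT

/-- **Bundle `PublishedInputsX8` (item 20403) from the four prints, Mazur's Manin-constant fact and PT-Ш(ℚ)**:
`publishedInputsX8_of_slim_poitouTate` with PT-Sel discharged. Conditional; closes nothing; BSD is not proved by this.
[cite: Sprung2024, §5.2] [cite: MilneADT2006, Ch. I, Thm. 4.10] -/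
theorem publishedInputsX8_of_slim_poitouTateSha
    (hBKO : InputBKOCorA5SharpFlat) (hmod : InputNewform) (hTors : InputSharpFlatTorsion) (hKato : InputKatoSharpFlatDivisibility)
    (hMazur : ModularForms.mazur_not_dvd_maninConstant_of_odd) (hPT : poitouTate_sha_tateDual ℚ) :
    Summit.BirchSwinnertonDyer.BirchSwinnertonDyer.Theses.PrintX8VS.PublishedInputsX8 :=
  publishedInputsX8_of_slim_poitouTate hBKO hmod hTors hKato hMazur
    (SchneiderFreeAdditiveX3.PoitouTateReduction.poitouTate_selmerStructure_duality_holds ℚ) hPT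

/-- **Bundle `PublishedInputsX8` (item 20403) from the four prints, the period child `InputPeriodUnitThree` and PT-Ш(ℚ)**:
`publishedInputsX8_of_slim_period_poitouTate` with PT-Sel discharged. Conditional; closes nothing; BSD is not proved by this.
[cite: Sprung2024, §5.2] [cite: MilneADT2006, Ch. I, Thm. 4.10] -/
theorem publishedInputsX8_of_slim_period_poitouTateSha
    (hBKO : InputBKOCorA5SharpFlat) (hmod : InputNewform) (hTors : InputSharpFlatTorsion) (hKato : InputKatoSharpFlatDivisibility)
    (hPer3 : InputPeriodUnitThree) (hPT : poitouTate_sha_tateDual ℚ) :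
    Summit.BirchSwinnertonDyer.BirchSwinnertonDyer.Theses.PrintX8VS.PublishedInputsX8 :=
  publishedInputsX8_of_slim_period_poitouTate hBKO hmod hTors hKato hPer3
    (SchneiderFreeAdditiveX3.PoitouTateReduction.poitouTate_selmerStructure_duality_holds ℚ) hPT

end Summit.BirchSwinnertonDyer.BirchSwinnertonDyer.Theorems

end
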